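import Summits.BirchSwinnertonDyer.BirchSwinnertonDyer.Theorems.GenusKolyvaginAtTwoPowDvdShaCardAtTwoRTEigenNorms
import HarnessLib

/-!
# Route `GenusKolyvaginAtTwo`, crux U_T `ShaCardDvdPowAtTwoRT` (stmt-BirchSwinnertonDyer-23658; upper half
# `#Ш(E/K)[2^∞] ∣ 2^(2M₀)`) — THE REGULAR FRAME IS COHOMOLOGICALLY TRIVIAL: coinvariants `A/(τ−1)A` cyclic of order `2^M` generated by `[P₀]`,
# `(τ−1)A` cyclic of order `2^M`, `ker(1+τ) = im(τ−1)`, `ker(τ−1) = im(1+τ)` — the `p = 2` substitute for the eigenline decomposition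

Seat `bsd-line-gk2-p3` g25 (PROVER seat 3/3, cell `bsd-f1-sign2`), `--supports stmt-BirchSwinnertonDyer-23658` (helper; closes nothing).
THEOREMS ONLY (pure algebra; no definition, no named fact, no `sorry`), in the frame of the LEAD's `…RTEigenNorms` §FreeRankOne (a free rank-one
`ℤ/2^M[C₂]`-module: involution `τ`, basis `P₀, τP₀` — `E[2^M]` on `Δ < 0` with `τ` = complex conjugation = `Frob_ℓ` at a Kolyvagin prime, gk2-p3
g23's `…RTRegularFrameAtTwo`).  BSD is NOT proved by any of this; neither is U_T nor any stub.

WHY (seat memo `Cruxes/ShaCardDvdPowAtTwoRT/Lines/norm-sharp-upper-gk2p3.md` §4, §10: stub «ℚ_ℓ cyclic local duality» of the twin-descent line for U_T).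
At `p` odd Howard/Jetchev split `E[p^M] = T⁺ ⊕ T⁻` into `τ`-eigenLINES (tree: `Howard2004.ResidualTauEigenlines*`, needs `2` invertible).  At
`p = 2` there is no such splitting; instead the regular frame is a FREE `ℤ/2^M[C₂]`-module, hence cohomologically trivial, and the objects that
replace the eigenlines are the four CYCLIC groups of order `2^M`: invariants `A^{τ} = ℤ(P₀+τP₀)` and anti-invariants `A^{τ=−1} = ℤ(P₀−τP₀)` (LEAD's
`exists_eq_zsmul_(co)norm_of_tau_eq(_neg)`, `addOrderOf_(co)norm_eq`), and — this file — the COINVARIANTS `A/(τ−1)A ≅ ℤ/2^M·[P₀]` and the image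
`(τ−1)A = ℤ(τP₀−P₀)`.  Over `ℚ_ℓ` at an inert Kolyvagin prime (`Frob_ℓ = τ` on `E[2^M]`, `FrobEqFrobInfty`): `H¹_ur(ℚ_ℓ, E[2^M]) ≅ E[2^M]/(Frob_ℓ−1)`
= the coinvariants (cyclic of order `2^M`), and `Ĥ^0 = Ĥ^{−1} = 0` (§2) make inflation–restriction `H¹(ℚ_ℓ, E[2^M]) ≅ H¹(K_λ, E[2^M])^{Gal(K_λ/ℚ_ℓ)}`
an isomorphism — the local frame over `ℚ_ℓ` is cyclic on both sides of the Tate duality, so McCallum's Lemma 5.3 loses no bit over `ℚ`.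
* §1 `exists_eq_zsmul_add_tau_sub` (every `x` is `c•P₀ + (τy − y)`), `two_pow_dvd_of_zsmul_eq_tau_sub` (`c•P₀ ∈ (τ−1)A ⟹ 2^M ∣ c`),
  `tau_sub_eq_zsmul_conorm` (`τy − y = a•(τP₀ − P₀)`), `addOrderOf_tau_sub_basis` (`τP₀ − P₀` has order `2^M`).
* §2 `exists_eq_tau_sub_of_add_tau_eq_zero` (`y + τy = 0 ⟹ y ∈ (τ−1)A`: `Ĥ^{−1} = 0`), `exists_eq_add_tau_of_tau_eq` (`τx = x ⟹ x ∈ (1+τ)A`: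
  `Ĥ^0 = 0`).

References: [McCallumLMS1991] §3 (the `⟨τ⟩`-basis of `E[p^M]`), §5 Lemma 5.3; [Brown, Cohomology of Groups, VI §8–9 (cohomologically trivial
modules)]; [Howard2004HeegnerKolyvagin] §1.3 H.5(a), Lemma 1.5.3 (the odd-`p` eigenline picture being replaced).
-/

set_option autoImplicit false

-- the Theorems namespace of this sub repeats the summit name by design (D-0017 nested layout)
set_option linter.dupNamespace false

namespace Summit.BirchSwinnertonDyer.BirchSwinnertonDyer.Theorems.GenusExact.PlusDescent

section FreeRankOne

variable {A : Type*} [AddCommGroup A]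
  (τ : A →+ A) (hτ : ∀ x, τ (τ x) = x) {M : ℕ} (P₀ : A)
  (hspan : ∀ Q : A, ∃ a b : ℤ, Q = a • P₀ + b • τ P₀)
  (hfree : ∀ a b : ℤ, a • P₀ + b • τ P₀ = 0 → (2 ^ M : ℤ) ∣ a ∧ (2 ^ M : ℤ) ∣ b)
  (htor : (2 ^ M : ℤ) • P₀ = 0)

/-! ## §1 Coinvariants and the image of `τ − 1` -/

include hspan in
/-- **Coinvariants are generated by `[P₀]`**: every `x` is `c • P₀ + (τy − y)` (`x = aP₀ + bτP₀ = (a+b)P₀ + (τ(bP₀) − bP₀)`). [folklore] -/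
theorem exists_eq_zsmul_add_tau_sub (x : A) : ∃ c : ℤ, ∃ y : A, x = c • P₀ + (τ y - y) := by
  obtain ⟨a, b, rfl⟩ := hspan x
  refine ⟨a + b, b • P₀, ?_⟩
  rw [map_zsmul, add_zsmul]
  abel

include hτ hspan hfree in
/-- **`[P₀]` has exact order `2^M` in the coinvariants**: `c • P₀ = τy − y ⟹ 2^M ∣ c` (write `y = aP₀ + bτP₀`; then `τy − y = (b−a)P₀ + (a−b)τP₀`,
and freeness gives `2^M ∣ c − (b − a)` and `2^M ∣ a − b`). [folklore] -/
theorem two_pow_dvd_of_zsmul_eq_tau_sub {c : ℤ} {y : A} (h : c • P₀ = τ y - y) : (2 ^ M : ℤ) ∣ c := by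
  obtain ⟨a, b, rfl⟩ := hspan y
  have hτy : τ (a • P₀ + b • τ P₀) = a • τ P₀ + b • P₀ := by rw [map_add, map_zsmul, map_zsmul, hτ]
  have hrel : (c - (b - a)) • P₀ + (b - a) • τ P₀ = 0 := by
    have h' : c • P₀ - (τ (a • P₀ + b • τ P₀) - (a • P₀ + b • τ P₀)) = 0 := by rw [h, sub_self]
    rw [hτy] at h'
    rw [← h', sub_zsmul, sub_zsmul, sub_zsmul]
    abel
  obtain ⟨h1, h2⟩ := hfree _ _ hrel
  have := dvd_add h1 h2
  rwa [sub_add_cancel] at this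

include hτ hspan in
/-- **`(τ − 1)A` is generated by `τP₀ − P₀`**: `τy − y = (a − b) • (τP₀ − P₀)` for `y = aP₀ + bτP₀`. [folklore] -/
theorem tau_sub_eq_zsmul_conorm (y : A) : ∃ a : ℤ, τ y - y = a • (τ P₀ - P₀) := by
  obtain ⟨a, b, rfl⟩ := hspan y
  refine ⟨a - b, ?_⟩
  rw [map_add, map_zsmul, map_zsmul, hτ, zsmul_sub, sub_zsmul, sub_zsmul]
  abel

include hfree htor in
/-- **`τP₀ − P₀` has order `2^M`** (so `(τ−1)A ≅ ℤ/2^M`). [folklore] -/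
theorem addOrderOf_tau_sub_basis : addOrderOf (τ P₀ - P₀) = 2 ^ M := by
  rw [← neg_sub, addOrderOf_neg]
  exact addOrderOf_conorm_eq τ P₀ hfree htor

/-! ## §2 Cohomological triviality: `Ĥ^{−1} = 0` and `Ĥ^0 = 0` -/

include hτ hspan hfree htor in
/-- **`Ĥ^{−1}(C₂, A) = 0`**: `y + τy = 0 ⟹ y = τz − z` (by `exists_eq_zsmul_conorm_of_tau_eq_neg`, `y = a(P₀ − τP₀) = τ(−aP₀) − (−aP₀)`). [folklore] -/
theorem exists_eq_tau_sub_of_add_tau_eq_zero {y : A} (hy : y + τ y = 0) : ∃ z : A, y = τ z - z := by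
  have hy' : τ y = -y := by rw [← add_eq_zero_iff_eq_neg']; exact hy
  obtain ⟨a, rfl⟩ := exists_eq_zsmul_conorm_of_tau_eq_neg τ hτ P₀ hspan hfree htor hy'
  refine ⟨-(a • P₀), ?_⟩
  rw [map_neg, map_zsmul, zsmul_sub]
  abel

include hτ hspan hfree htor in
/-- **`Ĥ^0(C₂, A) = 0`**: `τx = x ⟹ x = z + τz` (by `exists_eq_zsmul_norm_of_tau_eq`, `x = a(P₀ + τP₀) = aP₀ + τ(aP₀)`). [folklore] -/
theorem exists_eq_add_tau_of_tau_eq {x : A} (hx : τ x = x) : ∃ z : A, x = z + τ z := by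
  obtain ⟨a, rfl⟩ := exists_eq_zsmul_norm_of_tau_eq τ hτ P₀ hspan hfree htor hx
  exact ⟨a • P₀, by rw [map_zsmul, zsmul_add]⟩

include hτ hspan hfree htor in
/-- **Summary — the four cyclic groups of the regular frame.**  `A^{τ} = ℤ(P₀+τP₀)` and `A^{τ=−1} = ℤ(τP₀−P₀) = (τ−1)A`, both of order `2^M`, and
`A = ℤP₀ + (τ−1)A` with `ℤP₀ ∩ (τ−1)A = 2^M ℤ P₀ = 0`: the invariants, the anti-invariants, the image of `τ−1` and the coinvariants are
each cyclic of order `2^M` — the `p = 2` replacement of Howard's H.5(a) eigenlines. [folklore] [cite: McCallumLMS1991, §3 and §5 Lemma 5.3] -/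
theorem regularFrame_cyclic_summary :
    (∀ x : A, τ x = x → ∃ a : ℤ, x = a • (P₀ + τ P₀)) ∧ (∀ y : A, τ y = -y → ∃ a : ℤ, y = a • (P₀ - τ P₀)) ∧
      (∀ x : A, ∃ c : ℤ, ∃ y : A, x = c • P₀ + (τ y - y)) ∧ (∀ (c : ℤ) (y : A), c • P₀ = τ y - y → (2 ^ M : ℤ) ∣ c) ∧
        addOrderOf (P₀ + τ P₀) = 2 ^ M ∧ addOrderOf (τ P₀ - P₀) = 2 ^ M :=
  ⟨fun _ hx ↦ exists_eq_zsmul_norm_of_tau_eq τ hτ P₀ hspan hfree htor hx,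
    fun _ hy ↦ exists_eq_zsmul_conorm_of_tau_eq_neg τ hτ P₀ hspan hfree htor hy,
    exists_eq_zsmul_add_tau_sub τ P₀ hspan, fun _ _ h ↦ two_pow_dvd_of_zsmul_eq_tau_sub τ hτ P₀ hspan hfree h,
    addOrderOf_norm_eq τ P₀ hfree htor, addOrderOf_tau_sub_basis τ P₀ hfree htor⟩

end FreeRankOne

end Summit.BirchSwinnertonDyer.BirchSwinnertonDyer.Theorems.GenusExact.PlusDescent
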